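/-
Copyright (c) 2026. All rights reserved.
Released under Apache 2.0 license as described in the file LICENSE.
Authors: HodgeCM publication cell (pub-hodgecm), GR lane, third hand (`pub-hodgecm-own-crow`).
-/
import Mathlib.MeasureTheory.Measure.Haar.NormedSpace
import HarnessLib

/-!
# A measurable real character of a locally compact group is continuous (Steinhaus–Weil)

Topic `MeasureTheory/Group`; namespace `Literature.MeasureTheory.Group`.  KERNEL ONLY: theorems; no definition, no
named fact, no `sorry`.

For a locally compact topological group `G` (Borel σ-algebra) and a map `φ : G → ℝ` with `φ(ab) = φ(a) + φ(b)`: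

* `continuous_of_map_mul_add_of_bounded` — if `|φ| ≤ M` on a neighbourhood of `1` then `φ` is continuous
  (`|φ(g)| = 2^{-k} |φ(g^{2^k})|` and `g ↦ g^{2^k}` is continuous: bounded near `1` ⇒ small near `1`; then translate);
* **`continuous_of_map_mul_add_of_measurable`** — if `φ` is Borel measurable it is continuous: on a set `A` of finite
  positive Haar measure `|φ| < n`, so `|φ| ≤ 2n` on the neighbourhood `A A⁻¹` of `1` (STEINHAUS' theorem,
  `MeasureTheory.Measure.div_mem_nhds_one_of_haar_pos_ne_top`) [HewittRoss1979, Thm. 22.18 (measurable homomorphisms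
  of locally compact groups are continuous); Banach 1932 for `G = ℝ`].  Mathlib has the statement for a SEMINORMED
  source group (`MonoidHom.continuous_of_measurable`); this file is the general locally compact version for real-valued
  (additively written) characters, e.g. `log` of a positive multiplicative scalar.

Use (GR lane of the Hodge/COR-CM cell, ROADMAP (A3)): the `L²`-norm scaling `c(s(g))` of the smooth metaplectic
operators along a homomorphic section `s : G(𝐀) → Mp_ψ(W_𝐀)ᶜᵒⁿᵗ` is multiplicative in `g` and measurable as soon as `s`
is continuous for the coefficient topology; hence continuous — which is what the "no-majorant" strong-continuity
criterion `Weil1964.adelicMpCont.continuous_toOp_unitaryLegL2_comp_apply_of_continuous` consumes.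

## References
* [HewittRoss1979] E. Hewitt, K. A. Ross, *Abstract Harmonic Analysis I*, 2nd ed. (1979), Thm. 22.18, Cor. 20.17 (Steinhaus).
-/

set_option autoImplicit false

noncomputable section

open _root_.MeasureTheory _root_.MeasureTheory.Measure Filter Set
open scoped Topology Pointwise

namespace Literature.MeasureTheory.Group

variable {G : Type*} [Group G]

/-- an additive character sends `1` to `0`. [folklore] -/
private theorem map_one_of_map_mul_add {φ : G → ℝ} (hφ : ∀ a b, φ (a * b) = φ a + φ b) : φ 1 = 0 := by
  have h := hφ 1 1
  rw [mul_one] at h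
  linarith

/-- `φ(a⁻¹) = -φ(a)`. [folklore] -/
private theorem map_inv_of_map_mul_add {φ : G → ℝ} (hφ : ∀ a b, φ (a * b) = φ a + φ b) (a : G) :
    φ a⁻¹ = -φ a := by
  have h := hφ a a⁻¹
  rw [mul_inv_cancel, map_one_of_map_mul_add hφ] at h
  linarith

/-- `φ(a^n) = n φ(a)`. [folklore] -/
private theorem map_pow_of_map_mul_add {φ : G → ℝ} (hφ : ∀ a b, φ (a * b) = φ a + φ b) (a : G) (n : ℕ) :
    φ (a ^ n) = n * φ a := by
  induction n with
  | zero => rw [pow_zero, map_one_of_map_mul_add hφ, Nat.cast_zero, zero_mul]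
  | succ n ih => rw [pow_succ, hφ, ih, Nat.cast_succ]; ring

variable [TopologicalSpace G] [IsTopologicalGroup G]

/-- **an additive real character bounded near `1` is continuous**: if `φ(ab) = φ(a) + φ(b)` and `|φ| ≤ M` on a
neighbourhood of `1`, then `φ` is continuous. [cite: HewittRoss1979, Thm. 22.18] -/
theorem continuous_of_map_mul_add_of_bounded {φ : G → ℝ} (hφ : ∀ a b, φ (a * b) = φ a + φ b)
    {U : Set G} (hU : U ∈ 𝓝 (1 : G)) {M : ℝ} (hM : ∀ g ∈ U, |φ g| ≤ M) : Continuous φ := by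
  -- continuity at `1`
  have h1 : Tendsto φ (𝓝 1) (𝓝 0) := by
    rw [Metric.tendsto_nhds]
    intro ε hε
    -- `M / 2^k < ε`
    obtain ⟨k, hk⟩ : ∃ k : ℕ, M < 2 ^ k * ε := by
      obtain ⟨k, hk⟩ := pow_unbounded_of_one_lt (M / ε) (by norm_num : (1 : ℝ) < 2)
      exact ⟨k, (div_lt_iff₀ hε).1 hk⟩
    have hV : (fun g : G => g ^ (2 ^ k)) ⁻¹' U ∈ 𝓝 (1 : G) := by
      refine (continuous_pow (2 ^ k)).continuousAt.preimage_mem_nhds ?_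
      rwa [one_pow]
    filter_upwards [hV] with g hg
    rw [Real.dist_eq, sub_zero]
    have hb := hM _ hg
    rw [map_pow_of_map_mul_add hφ, abs_mul, Nat.abs_cast, Nat.cast_pow, Nat.cast_ofNat] at hb
    have h2k : (0 : ℝ) < 2 ^ k := by positivity
    nlinarith
  -- continuity everywhere by translation
  refine continuous_iff_continuousAt.2 fun g₀ => ?_
  have hφeq : φ = fun g => φ (g * g₀⁻¹) + φ g₀ := by
    funext g
    rw [← hφ, inv_mul_cancel_right]
  rw [ContinuousAt, hφeq]
  simp only
  have ht : Tendsto (fun g : G => g * g₀⁻¹) (𝓝 g₀) (𝓝 1) := by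
    have h := ((continuous_mul_const g₀⁻¹).tendsto g₀ : Tendsto (fun g : G => g * g₀⁻¹) (𝓝 g₀) (𝓝 (g₀ * g₀⁻¹)))
    rwa [mul_inv_cancel] at h
  have h := (h1.comp ht).add (tendsto_const_nhds (x := φ g₀))
  rw [zero_add] at h
  have e : φ (g₀ * g₀⁻¹) + φ g₀ = φ g₀ := by rw [mul_inv_cancel, map_one_of_map_mul_add hφ, zero_add]
  rw [e]
  exact h

variable [MeasurableSpace G] [BorelSpace G] [LocallyCompactSpace G]

/-- **STEINHAUS–WEIL AUTOMATIC CONTINUITY**: a Borel measurable map `φ : G → ℝ` on a locally compact group with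
`φ(ab) = φ(a) + φ(b)` is continuous.  Proof: for some `n` the set `A = K° ∩ {|φ| < n}` (`K` a compact neighbourhood)
has finite positive Haar measure; by Steinhaus `A A⁻¹` is a neighbourhood of `1`, on which `|φ| ≤ 2n`.
[cite: HewittRoss1979, Thm. 22.18] -/
theorem continuous_of_map_mul_add_of_measurable {φ : G → ℝ} (hφ : ∀ a b, φ (a * b) = φ a + φ b)
    (hm : Measurable φ) : Continuous φ := by
  let K : TopologicalSpace.PositiveCompacts G := Classical.arbitrary _
  -- a piece of `K°` of positive measure on which `φ` is bounded
  obtain ⟨n, hn⟩ : ∃ n : ℕ, 0 < haar (interior (K : Set G) ∩ φ ⁻¹' Metric.ball 0 n) := by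
    by_contra! h
    simp_rw [nonpos_iff_eq_zero, ← measure_iUnion_null_iff, ← inter_iUnion, ← preimage_iUnion,
      Metric.iUnion_ball_nat, preimage_univ, inter_univ] at h
    exact (isOpen_interior.measure_pos haar K.interior_nonempty).ne' h
  set A : Set G := interior (K : Set G) ∩ φ ⁻¹' Metric.ball 0 n with hA_def
  have hAm : MeasurableSet A := isOpen_interior.measurableSet.inter (hm measurableSet_ball)
  have hAfin : haar A ≠ ⊤ :=
    ((measure_mono (inter_subset_left.trans interior_subset)).trans_lt K.isCompact.measure_lt_top).ne
  have hU : A / A ∈ 𝓝 (1 : G) := div_mem_nhds_one_of_haar_pos_ne_top haar A hAm hn hAfin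
  refine continuous_of_map_mul_add_of_bounded hφ hU (M := 2 * n) fun g hg => ?_
  obtain ⟨a, ha, b, hb, rfl⟩ := Set.mem_div.1 hg
  have ha' : |φ a| < n := by simpa [hA_def, Real.dist_eq] using ha.2
  have hb' : |φ b| < n := by simpa [hA_def, Real.dist_eq] using hb.2
  rw [div_eq_mul_inv, hφ, map_inv_of_map_mul_add hφ]
  have := abs_add_le (φ a) (-φ b)
  rw [abs_neg] at this
  linarith

/-- the multiplicative reading: a Borel measurable `c : G → ℝ` with `c(ab) = c(a) c(b)` and `0 < c` is continuous
(apply the additive statement to `log c`). [cite: HewittRoss1979, Thm. 22.18] -/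
theorem continuous_of_map_mul_mul_of_measurable_of_pos {c : G → ℝ} (hc : ∀ a b, c (a * b) = c a * c b)
    (hpos : ∀ a, 0 < c a) (hm : Measurable c) : Continuous c := by
  have hlog : Continuous fun g => Real.log (c g) :=
    continuous_of_map_mul_add_of_measurable (φ := fun g => Real.log (c g))
      (fun a b => by rw [hc, Real.log_mul (hpos a).ne' (hpos b).ne']) (Real.measurable_log.comp hm)
  have : c = fun g => Real.exp (Real.log (c g)) := funext fun g => (Real.exp_log (hpos g)).symm
  rw [this]
  exact Real.continuous_exp.comp hlog

end Literature.MeasureTheory.Group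

end
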